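import Summits.Parity.BatemanHorn.Theorems.AlmostPrimeZerosSystemMomentDeficitLocalisationBlocks
import Summits.Parity.BatemanHorn.Theorems.AlmostPrimeZerosSystemMomentDeficitLocalisationCovariance
import Summits.Parity.BatemanHorn.Theorems.AlmostPrimeZerosSystemMomentDeficitNearPairCovUpper
import Summits.Parity.BatemanHorn.Theorems.AlmostPrimeZerosSystemMomentDeficitAssemblyBlocks
import Summits.Parity.BatemanHorn.Theorems.AlmostPrimeZerosSystemMomentDeficitNearPairCov
import Summits.Parity.BatemanHorn.Theorems.AlmostPrimeZerosSystemMomentDeficitPairBookkeeping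
import Summits.Parity.BatemanHorn.Theses.AlmostPrimeZeros
import Literature.NumberTheory.Sieve.BatemanHornLocalCounts
import Literature.NumberTheory.LFunctions.MertensElementary

/-!
# Crux `SystemMomentDeficit` (stmt-Parity-11326): two-sided localisation of the moment deficit — core

Route `AlmostPrimeZeros`, crux `Summit.Parity.BatemanHorn.Theses.AlmostPrimeZeros.SystemMomentDeficit`
(rank 4): for every Bateman–Horn system `f`, `m₁(x) − v(x) ≤ C_f` for the capped statistic
`s_f(n) = Σᵢ Σ_{p^v ∥ fᵢ(n)⁺} min(v, 2)`, `m₁` its mean and `v` its variance over `0 ≤ n ≤ x`.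

Split `s_f = A + B` at height `√x`: `A(n) = Σᵢ #{q ∈ PP(⌊√x⌋) : q ∣ fᵢ(n)⁺ ≠ 0}` counts the prime
powers `q ≤ √x` (primes and prime squares) dividing the values, `B = s_f − A ∈ [0, K_f]` the capped
count of the prime(-square) factors beyond `√x` (at most `2(2 deg fᵢ + H(fᵢ))` per member).  This file
proves the CORE ESTIMATE `localisation_core`: for `x ≥ 4`,

* `|(m₁ − v)(x) + 2·Cov_x(A, B)| ≤ C₁` — the two other blocks of
  `m₁ − v = (E A − Var A) + (E B − Var B) − 2Cov(A, B)` are TWO-sidedly bounded: `E A − Var A` by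
  the pair expansion over `PP(√x)²` (coprime pairs are CRT-near since `qq' ≤ x`, two-sided termwise
  covariance bounds `stub_nearPairCov` / `nearPairCov_upper`; same-prime pairs by `Σ 1/p² ≤ 1` and
  Bateman–Horn's resultant argument `exists_forall_not_dvd_eval_and_dvd_eval`; blocks
  `Ideator3Sketch.ablock_le`, `Localisation.ablock_ge`), and `E B − Var B ∈ [−K², K]`;
* `|Cov_x(A, B)| ≤ C₂ (1 + √(log log x))` — Cauchy–Schwarz (`abs_cov_le_sqrt_mul_sqrt`) with
  `Var B ≤ K²` and `Var A ≤ E A + O(1) ≤ 2Dk(log log x + 5) + O(1)` (Mertens,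
  `MertensBound.sum_inv_prime_le`).

The consequences (the two-sided localisation `crux(f) ⟺ Cov_x(A, B) ≥ −C`, and the unconditional
state-of-the-art bound `|m₁(x) − v(x)| ≤ C_f(1 + √(log log x))`) are drawn in
`AlmostPrimeZerosSystemMomentDeficitLocalisation.lean`.

Notation (docstrings only).  `Y = x + 1`, `E g = Y⁻¹ Σ_{0 ≤ n ≤ x} g(n)`, `PP(z)` = primes `≤ z` ∪
prime squares `≤ z`, `D = Σᵢ deg fᵢ · Mᵢ` (Hooley's uniform root bound), `K = Σᵢ 2(2 deg fᵢ + H(fᵢ))`.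
Everything is [folklore] bookkeeping over the landed blocks; no definitions are introduced.
-/

namespace Summit.Parity.BatemanHorn.Cruxes.SystemMomentDeficit.Localisation

open scoped BigOperators
open Finset Polynomial Filter
open Literature.NumberTheory.Sieve
open Summit.Parity.BatemanHorn.Theorems.AlmostPrimeZeros.SystemMertens
open Summit.Parity.BatemanHorn.Cruxes.SystemMomentDeficit.Ideator3Sketch

/-- The capped statistic exceeds the small count at height `⌊√x⌋` by at most `2(2d + H)` along the
values `g(n)⁺`, `0 ≤ n ≤ x`, `x ≥ 1` (`H = Σ |coeff|`; `g(n)⁺ ≤ H(x+1)^d ≤ H(⌊√x⌋+1)^{2d}`, so at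
most `2d + H` prime factors `> √x` and at most `2d + H` prime-square factors `> √x`). [folklore] -/
theorem capped_le_card_PP_sqrt_filter_add (g : ℤ[X]) {n x : ℕ} (hx : 1 ≤ x) (hn : n ≤ x) :
    ((g.eval (n : ℤ)).toNat.factorization.sum fun _ v => min v 2) ≤
      #((Nat.primesLE (Nat.sqrt x) ∪ ((Nat.primesLE (Nat.sqrt x)).filter
          (fun p => p ^ 2 ≤ Nat.sqrt x)).image (fun p => p ^ 2)).filter
          (fun q => q ∣ (g.eval (n : ℤ)).toNat ∧ (g.eval (n : ℤ)).toNat ≠ 0)) +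
        2 * (2 * g.natDegree + ∑ j ∈ range (g.natDegree + 1), (g.coeff j).natAbs) := by
  rw [card_PP_filter_dvd]
  have hz1 : 1 ≤ Nat.sqrt x := Nat.le_sqrt.2 (by omega)
  have hpow : (x + 1) ^ g.natDegree ≤ (Nat.sqrt x + 1) ^ (2 * g.natDegree) := by
    have h1 : x + 1 ≤ (Nat.sqrt x + 1) * (Nat.sqrt x + 1) := Nat.lt_succ_sqrt x
    calc (x + 1) ^ g.natDegree ≤ ((Nat.sqrt x + 1) * (Nat.sqrt x + 1)) ^ g.natDegree :=
          Nat.pow_le_pow_left h1 _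
      _ = (Nat.sqrt x + 1) ^ (2 * g.natDegree) := by rw [← pow_two, ← pow_mul]
  have hm : (g.eval (n : ℤ)).toNat ≤
      (∑ j ∈ range (g.natDegree + 1), (g.coeff j).natAbs) * (Nat.sqrt x + 1) ^ (2 * g.natDegree) :=
    (toNat_eval_le g hn).trans (Nat.mul_le_mul_left _ hpow)
  have := capped_le_card_add hz1 hm
  omega

set_option maxHeartbeats 800000 in -- one long bookkeeping proof (≈ 2× the default budget)
/-- **Core estimate of the two-sided localisation.**  For a Bateman–Horn system `f` there are
`C₁, C₂` such that for every `x ≥ 4`, with `A(n) = Σᵢ #{q ∈ PP(⌊√x⌋) : q ∣ fᵢ(n)⁺ ≠ 0}`,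
`s(n) = s_f(n)` and `B = s − A` (all over `0 ≤ n ≤ x`):
`|(m₁ − v)(x) + 2·Cov_x(A, B)| ≤ C₁` and `|Cov_x(A, B)| ≤ C₂ (1 + √(log log x))`, where
`(m₁ − v)(x)` is written exactly as in the crux `SystemMomentDeficit`. [folklore] -/
theorem localisation_core :
    ∀ (k : ℕ) (f : Fin k → ℤ[X]), IsBatemanHornSystem f →
    ∃ C₁ C₂ : ℝ, ∀ x : ℕ, 4 ≤ x →
      |((∑ n ∈ Finset.range (x + 1), ∑ i, (((f i).eval (n : ℤ)).toNat.factorization.sum fun _ v => min v 2) : ℕ) : ℝ) / ((x : ℝ) + 1) -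
        (((∑ n ∈ Finset.range (x + 1), (∑ i, (((f i).eval (n : ℤ)).toNat.factorization.sum fun _ v => min v 2)) ^ 2 : ℕ) : ℝ) / ((x : ℝ) + 1) -
          (((∑ n ∈ Finset.range (x + 1), ∑ i, (((f i).eval (n : ℤ)).toNat.factorization.sum fun _ v => min v 2) : ℕ) : ℝ) / ((x : ℝ) + 1)) ^ 2) +
        2 * ((∑ n ∈ Finset.range (x + 1),
          ((∑ i, #((Nat.primesLE (Nat.sqrt x) ∪ ((Nat.primesLE (Nat.sqrt x)).filter (fun p => p ^ 2 ≤ Nat.sqrt x)).image (fun p => p ^ 2)).filter (fun q => q ∣ ((f i).eval (n : ℤ)).toNat ∧ ((f i).eval (n : ℤ)).toNat ≠ 0)) : ℕ) : ℝ) *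
            (((∑ i, (((f i).eval (n : ℤ)).toNat.factorization.sum fun _ v => min v 2) : ℕ) : ℝ) -
              ((∑ i, #((Nat.primesLE (Nat.sqrt x) ∪ ((Nat.primesLE (Nat.sqrt x)).filter (fun p => p ^ 2 ≤ Nat.sqrt x)).image (fun p => p ^ 2)).filter (fun q => q ∣ ((f i).eval (n : ℤ)).toNat ∧ ((f i).eval (n : ℤ)).toNat ≠ 0)) : ℕ) : ℝ))) / ((x : ℝ) + 1) -
        (∑ n ∈ Finset.range (x + 1),
          ((∑ i, #((Nat.primesLE (Nat.sqrt x) ∪ ((Nat.primesLE (Nat.sqrt x)).filter (fun p => p ^ 2 ≤ Nat.sqrt x)).image (fun p => p ^ 2)).filter (fun q => q ∣ ((f i).eval (n : ℤ)).toNat ∧ ((f i).eval (n : ℤ)).toNat ≠ 0)) : ℕ) : ℝ)) / ((x : ℝ) + 1) *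
          ((∑ n ∈ Finset.range (x + 1),
            (((∑ i, (((f i).eval (n : ℤ)).toNat.factorization.sum fun _ v => min v 2) : ℕ) : ℝ) -
              ((∑ i, #((Nat.primesLE (Nat.sqrt x) ∪ ((Nat.primesLE (Nat.sqrt x)).filter (fun p => p ^ 2 ≤ Nat.sqrt x)).image (fun p => p ^ 2)).filter (fun q => q ∣ ((f i).eval (n : ℤ)).toNat ∧ ((f i).eval (n : ℤ)).toNat ≠ 0)) : ℕ) : ℝ))) / ((x : ℝ) + 1)))| ≤ C₁ ∧
      |(∑ n ∈ Finset.range (x + 1),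
          ((∑ i, #((Nat.primesLE (Nat.sqrt x) ∪ ((Nat.primesLE (Nat.sqrt x)).filter (fun p => p ^ 2 ≤ Nat.sqrt x)).image (fun p => p ^ 2)).filter (fun q => q ∣ ((f i).eval (n : ℤ)).toNat ∧ ((f i).eval (n : ℤ)).toNat ≠ 0)) : ℕ) : ℝ) *
            (((∑ i, (((f i).eval (n : ℤ)).toNat.factorization.sum fun _ v => min v 2) : ℕ) : ℝ) -
              ((∑ i, #((Nat.primesLE (Nat.sqrt x) ∪ ((Nat.primesLE (Nat.sqrt x)).filter (fun p => p ^ 2 ≤ Nat.sqrt x)).image (fun p => p ^ 2)).filter (fun q => q ∣ ((f i).eval (n : ℤ)).toNat ∧ ((f i).eval (n : ℤ)).toNat ≠ 0)) : ℕ) : ℝ))) / ((x : ℝ) + 1) -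
        (∑ n ∈ Finset.range (x + 1),
          ((∑ i, #((Nat.primesLE (Nat.sqrt x) ∪ ((Nat.primesLE (Nat.sqrt x)).filter (fun p => p ^ 2 ≤ Nat.sqrt x)).image (fun p => p ^ 2)).filter (fun q => q ∣ ((f i).eval (n : ℤ)).toNat ∧ ((f i).eval (n : ℤ)).toNat ≠ 0)) : ℕ) : ℝ)) / ((x : ℝ) + 1) *
          ((∑ n ∈ Finset.range (x + 1),
            (((∑ i, (((f i).eval (n : ℤ)).toNat.factorization.sum fun _ v => min v 2) : ℕ) : ℝ) -
              ((∑ i, #((Nat.primesLE (Nat.sqrt x) ∪ ((Nat.primesLE (Nat.sqrt x)).filter (fun p => p ^ 2 ≤ Nat.sqrt x)).image (fun p => p ^ 2)).filter (fun q => q ∣ ((f i).eval (n : ℤ)).toNat ∧ ((f i).eval (n : ℤ)).toNat ≠ 0)) : ℕ) : ℝ))) / ((x : ℝ) + 1))| ≤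
        C₂ * (1 + Real.sqrt (Real.log (Real.log x))) := by
  intro k f hf
  classical
  /- ### constants (independent of `x`) -/
  choose Cp hCp using fun i j => stub_nearPairCov stub_crtPairCount (f i) (f j) (hf.irreducible i)
    (hf.natDegree_pos i) (hf.leadingCoeff_pos i) (hf.irreducible j) (hf.natDegree_pos j)
    (hf.leadingCoeff_pos j)
  choose Cu hCu using fun i j => nearPairCov_upper (f i) (f j) (hf.irreducible i)
    (hf.natDegree_pos i) (hf.leadingCoeff_pos i) (hf.irreducible j) (hf.natDegree_pos j)
    (hf.leadingCoeff_pos j)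
  choose M hM1 hM hρ using fun i => exists_rootCount_primePow_le (hf.irreducible i) (hf.natDegree_pos i)
  obtain ⟨P₀, hP₀⟩ := exists_forall_not_dvd_eval_and_dvd_eval hf.irreducible hf.pairwise_not_associated
  set D : ℝ := ∑ i, ((f i).natDegree : ℝ) * (M i : ℝ) with hD
  set K : ℝ := ∑ i, (2 * ((2 * ((f i).natDegree : ℝ)) +
    ((∑ j ∈ range ((f i).natDegree + 1), ((f i).coeff j).natAbs : ℕ) : ℝ))) with hK
  set CpS : ℝ := ∑ i, ∑ j, max (Cp i j) 0 with hCpS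
  set CpU : ℝ := ∑ i, ∑ j, max (Cu i j) 0 with hCpU
  set Cle : ℝ := (k : ℝ) ^ 2 * (2 * CpS + 32 * D ^ 2) with hCle
  set Cge : ℝ := (k : ℝ) ^ 2 * (2 * CpU + 8 * ((P₀ : ℝ) + 1) ^ 4 + 4 * D) with hCge
  set β : ℝ := 2 * D * k * 5 + Cge with hβ
  have hD0 : 0 ≤ D := sum_nonneg fun i _ => by positivity
  have hK0 : 0 ≤ K := sum_nonneg fun i _ => by positivity
  have hCpS0 : 0 ≤ CpS := sum_nonneg fun i _ => sum_nonneg fun j _ => le_max_right _ _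
  have hCpU0 : 0 ≤ CpU := sum_nonneg fun i _ => sum_nonneg fun j _ => le_max_right _ _
  have hCle0 : 0 ≤ Cle := by positivity
  have hCge0 : 0 ≤ Cge := by positivity
  have hβ0 : 0 ≤ β := by positivity
  have hCp_le : ∀ i j, Cp i j ≤ CpS := fun i j =>
    (le_max_left _ _).trans
      ((single_le_sum (f := fun j => max (Cp i j) 0) (fun j _ => le_max_right _ _) (mem_univ j)).trans
        (single_le_sum (f := fun i => ∑ j, max (Cp i j) 0)
          (fun i _ => sum_nonneg fun j _ => le_max_right _ _) (mem_univ i)))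
  have hCu_le : ∀ i j, Cu i j ≤ CpU := fun i j =>
    (le_max_left _ _).trans
      ((single_le_sum (f := fun j => max (Cu i j) 0) (fun j _ => le_max_right _ _) (mem_univ j)).trans
        (single_le_sum (f := fun i => ∑ j, max (Cu i j) 0)
          (fun i _ => sum_nonneg fun j _ => le_max_right _ _) (mem_univ i)))
  refine ⟨Cle + K + Cge + K ^ 2, K * (Real.sqrt (2 * D * k) + Real.sqrt β), fun x hx => ?_⟩
  /- ### parameters at `x` -/
  set z : ℕ := Nat.sqrt x with hz
  have hx1 : 1 ≤ x := by omega
  have hz2 : 2 ≤ z := Nat.le_sqrt.2 (by omega)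
  have hzx : z ≤ x := Nat.sqrt_le_self x
  have hzz : z * z ≤ x := Nat.sqrt_le x
  have hY0 : (0 : ℝ) < (x : ℝ) + 1 := by positivity
  -- logarithms: `0 ≤ log log x`, `log log z ≤ log log x`
  have hlog2 : (0 : ℝ) < Real.log 2 := Real.log_pos one_lt_two
  have hzR : (2 : ℝ) ≤ (z : ℝ) := by exact_mod_cast hz2
  have hxR : (z : ℝ) ≤ (x : ℝ) := by exact_mod_cast hzx
  have hlogz0 : 0 < Real.log z := Real.log_pos (by linarith)
  have hlogzx : Real.log z ≤ Real.log x := Real.log_le_log (by linarith) hxR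
  have hllzx : Real.log (Real.log z) ≤ Real.log (Real.log x) := Real.log_le_log hlogz0 hlogzx
  have hll0 : 0 ≤ Real.log (Real.log x) := by
    have h4 : (4 : ℝ) ≤ x := by exact_mod_cast hx
    have hlog4 : (1 : ℝ) ≤ Real.log 4 := by
      rw [Real.le_log_iff_exp_le (by norm_num)]
      have := Real.exp_one_lt_d9
      linarith
    have : (1 : ℝ) ≤ Real.log x := hlog4.trans (Real.log_le_log (by norm_num) h4)
    exact Real.log_nonneg this
  /- ### the indicators `Zf (i, q)` -/
  set Zf : Fin k × ℕ → ℕ → ℝ := fun t n =>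
    if t.2 ∣ ((f t.1).eval (n : ℤ)).toNat ∧ ((f t.1).eval (n : ℤ)).toNat ≠ 0 then 1 else 0 with hZf
  have hZfdef : ∀ t n, Zf t n =
      if t.2 ∣ ((f t.1).eval (n : ℤ)).toNat ∧ ((f t.1).eval (n : ℤ)).toNat ≠ 0 then 1 else 0 :=
    fun t n => by rw [hZf]
  have hZf01 : ∀ t n, Zf t n = 0 ∨ Zf t n = 1 := fun t n => by
    simp only [hZf]; split_ifs <;> simp
  have hZf0 : ∀ t n, 0 ≤ Zf t n := fun t n => by rcases hZf01 t n with h | h <;> simp [h]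
  have hZsum : ∀ t, ∑ n ∈ range (x + 1), Zf t n =
      (#((range (x + 1)).filter fun n : ℕ =>
        t.2 ∣ ((f t.1).eval (n : ℤ)).toNat ∧ ((f t.1).eval (n : ℤ)).toNat ≠ 0) : ℝ) := fun t => by
    simp only [hZf]
    rw [sum_boole]
  have hZsum2 : ∀ t t', ∑ n ∈ range (x + 1), Zf t n * Zf t' n =
      (#((range (x + 1)).filter fun n : ℕ =>
        (t.2 ∣ ((f t.1).eval (n : ℤ)).toNat ∧ ((f t.1).eval (n : ℤ)).toNat ≠ 0) ∧
          (t'.2 ∣ ((f t'.1).eval (n : ℤ)).toNat ∧ ((f t'.1).eval (n : ℤ)).toNat ≠ 0)) : ℝ) := by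
    intro t t'
    simp only [hZf, ite_one_zero_mul_ite]
    rw [sum_boole]
  have hZcard : ∀ (i : Fin k) (S : Finset ℕ) (n : ℕ), ∑ q ∈ S, Zf (i, q) n =
      (#(S.filter (fun q => q ∣ ((f i).eval (n : ℤ)).toNat ∧ ((f i).eval (n : ℤ)).toNat ≠ 0)) : ℝ) := by
    intro i S n
    simp only [hZf]
    rw [sum_boole]
  -- root-class bound for the means: `E 1_{i,q} ≤ 2D/q` for `q ∈ PP(x)`
  have he : ∀ t : Fin k × ℕ, t.2 ∈ (Nat.primesLE x ∪ ((Nat.primesLE x).filter (fun p => p ^ 2 ≤ x)).image (fun p => p ^ 2)) →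
      (∑ n ∈ range (x + 1), Zf t n) / ((x : ℝ) + 1) ≤ 2 * D / (t.2 : ℝ) := by
    rintro ⟨i, q⟩ hq
    obtain ⟨hpp, hq2, hqx⟩ := isPrimePow_and_le_of_mem_PP hq
    have hq0 : 0 < q := by omega
    have hqR : (0 : ℝ) < q := by exact_mod_cast hq0
    rw [hZsum]
    refine (card_filter_dvd_toNat_div_le (f i) hq0 x).trans ?_
    obtain ⟨p, a, hp, ha, rfl⟩ := (isPrimePow_nat_iff q).1 hpp
    have hρD : (polyRootCountMod ![f i] (p ^ a) : ℝ) ≤ D := by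
      have h1 : (polyRootCountMod ![f i] (p ^ a) : ℝ) ≤ ((f i).natDegree : ℝ) * (M i : ℝ) := by
        exact_mod_cast hM i p hp a
      exact h1.trans (single_le_sum (f := fun i => ((f i).natDegree : ℝ) * (M i : ℝ))
        (fun i _ => by positivity) (mem_univ i))
    have hY' : 1 / ((x : ℝ) + 1) ≤ 1 / ((p ^ a : ℕ) : ℝ) :=
      one_div_le_one_div_of_le hqR (by exact_mod_cast Nat.le_succ_of_le hqx)
    calc (polyRootCountMod ![f i] (p ^ a) : ℝ) * (1 / ((p ^ a : ℕ) : ℝ) + 1 / ((x : ℝ) + 1))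
        ≤ D * (1 / ((p ^ a : ℕ) : ℝ) + 1 / ((x : ℝ) + 1)) :=
          mul_le_mul_of_nonneg_right hρD (by positivity)
      _ ≤ D * (1 / ((p ^ a : ℕ) : ℝ) + 1 / ((p ^ a : ℕ) : ℝ)) :=
          mul_le_mul_of_nonneg_left (add_le_add_right hY' _) hD0
      _ = 2 * D / ((p ^ a : ℕ) : ℝ) := by ring
  -- the two termwise near-pair covariance bounds in `Zf`-form
  have hpair : ∀ t t' : Fin k × ℕ, t.2 ∈ (Nat.primesLE x ∪ ((Nat.primesLE x).filter (fun p => p ^ 2 ≤ x)).image (fun p => p ^ 2)) → t'.2 ∈ (Nat.primesLE x ∪ ((Nat.primesLE x).filter (fun p => p ^ 2 ≤ x)).image (fun p => p ^ 2)) → Nat.Coprime t.2 t'.2 →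
      (∑ n ∈ range (x + 1), Zf t n) / ((x : ℝ) + 1) * ((∑ n ∈ range (x + 1), Zf t' n) / ((x : ℝ) + 1)) -
        (∑ n ∈ range (x + 1), Zf t n * Zf t' n) / ((x : ℝ) + 1) ≤ CpS / ((x : ℝ) + 1) := by
    rintro ⟨i, q⟩ ⟨j, q'⟩ hq hq' hcop
    rw [hZsum, hZsum, hZsum2]
    exact (hCp i j x q q' (isPrimePow_and_le_of_mem_PP hq).1 (isPrimePow_and_le_of_mem_PP hq').1
      hcop).trans (div_le_div_of_nonneg_right (hCp_le i j) hY0.le)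
  have hpairU : ∀ t t' : Fin k × ℕ, t.2 ∈ (Nat.primesLE x ∪ ((Nat.primesLE x).filter (fun p => p ^ 2 ≤ x)).image (fun p => p ^ 2)) → t'.2 ∈ (Nat.primesLE x ∪ ((Nat.primesLE x).filter (fun p => p ^ 2 ≤ x)).image (fun p => p ^ 2)) → Nat.Coprime t.2 t'.2 →
      (∑ n ∈ range (x + 1), Zf t n * Zf t' n) / ((x : ℝ) + 1) -
        (∑ n ∈ range (x + 1), Zf t n) / ((x : ℝ) + 1) * ((∑ n ∈ range (x + 1), Zf t' n) / ((x : ℝ) + 1)) ≤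
        CpU / ((x : ℝ) + 1) := by
    rintro ⟨i, q⟩ ⟨j, q'⟩ hq hq' hcop
    rw [hZsum, hZsum, hZsum2]
    exact (hCu i j x q q' (isPrimePow_and_le_of_mem_PP hq).1 (isPrimePow_and_le_of_mem_PP hq').1
      hcop).trans (div_le_div_of_nonneg_right (hCu_le i j) hY0.le)
  have hcross : ∀ i j : Fin k, i ≠ j → ∀ p : ℕ, P₀ < p → ∀ n : ℤ,
      ¬ ((p : ℤ) ∣ (f i).eval n ∧ (p : ℤ) ∣ (f j).eval n) := fun i j hij p hp n => hP₀ p hp i j hij n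
  /- ### the two blocks `E a − Var a` (two-sided) -/
  have hFa_le := ablock_le k Zf x z D CpS hD0 hCpS0 hzx hzz hZf01 he hpair
    (stub_pairBookkeeping x).1 (stub_pairBookkeeping x).2
  have hFa_ge := ablock_ge k f x z P₀ Zf D CpU hD0 hCpU0 hzx hzz hZfdef he hpairU hcross
    (stub_pairBookkeeping x).1 (stub_pairBookkeeping x).2
  /- ### the functions `a`, `sN`, `b` -/
  obtain ⟨a, ha⟩ : ∃ a : ℕ → ℝ, a = fun n => ∑ t ∈ (univ : Finset (Fin k)) ×ˢ (Nat.primesLE z ∪ ((Nat.primesLE z).filter (fun p => p ^ 2 ≤ z)).image (fun p => p ^ 2)), Zf t n := ⟨_, rfl⟩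
  obtain ⟨sN, hsN⟩ : ∃ sN : ℕ → ℝ, sN = fun n : ℕ =>
      ((∑ i, (((f i).eval (n : ℤ)).toNat.factorization.sum fun _ v => min v 2) : ℕ) : ℝ) := ⟨_, rfl⟩
  obtain ⟨b, hb⟩ : ∃ b : ℕ → ℝ, b = fun n => sN n - a n := ⟨_, rfl⟩
  have haf : ∀ n : ℕ, ∑ t ∈ (univ : Finset (Fin k)) ×ˢ (Nat.primesLE z ∪ ((Nat.primesLE z).filter (fun p => p ^ 2 ≤ z)).image (fun p => p ^ 2)), Zf t n = a n := fun n => by rw [ha]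
  have ha_i : ∀ n : ℕ, a n = ∑ i, (#((Nat.primesLE z ∪ ((Nat.primesLE z).filter (fun p => p ^ 2 ≤ z)).image (fun p => p ^ 2)).filter
      (fun q => q ∣ ((f i).eval (n : ℤ)).toNat ∧ ((f i).eval (n : ℤ)).toNat ≠ 0)) : ℝ) := fun n => by
    rw [ha]
    simp only
    rw [sum_product]
    exact sum_congr rfl fun i _ => hZcard i _ n
  have hA_eq : ∀ n : ℕ, ((∑ i, #((Nat.primesLE z ∪ ((Nat.primesLE z).filter (fun p => p ^ 2 ≤ z)).image (fun p => p ^ 2)).filter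
      (fun q => q ∣ ((f i).eval (n : ℤ)).toNat ∧ ((f i).eval (n : ℤ)).toNat ≠ 0)) : ℕ) : ℝ) = a n := fun n => by
    rw [ha_i n, Nat.cast_sum]
  have hsN_i : ∀ n : ℕ, sN n = ∑ i, ((((f i).eval (n : ℤ)).toNat.factorization.sum fun _ v => min v 2 : ℕ) : ℝ) :=
    fun n => by rw [hsN]; simp only [Nat.cast_sum]
  have hab : ∀ n : ℕ, a n + b n = sN n := fun n => by rw [hb]; simp only; ring
  simp only [haf] at hFa_le hFa_ge
  -- pointwise bounds `0 ≤ b ≤ K` on `range (x+1)`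
  have hb0 : ∀ n ∈ range (x + 1), 0 ≤ b n := fun n _ => by
    rw [hb]
    simp only [sub_nonneg]
    rw [ha_i, hsN_i]
    exact sum_le_sum fun i _ => by exact_mod_cast card_PP_filter_le_capped z _
  have hbK : ∀ n ∈ range (x + 1), b n ≤ K := fun n hn => by
    have hnx : n ≤ x := Nat.lt_succ_iff.1 (mem_range.1 hn)
    rw [hb]
    simp only
    rw [ha_i, hsN_i, hK, sub_le_iff_le_add, ← sum_add_distrib]
    refine sum_le_sum fun i _ => ?_
    have h1 := capped_le_card_PP_sqrt_filter_add (f i) hx1 hnx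
    have h2 : (((((f i).eval (n : ℤ)).toNat.factorization.sum fun _ v => min v 2) : ℕ) : ℝ) ≤
        (#((Nat.primesLE (Nat.sqrt x) ∪ ((Nat.primesLE (Nat.sqrt x)).filter
          (fun p => p ^ 2 ≤ Nat.sqrt x)).image (fun p => p ^ 2)).filter
          (fun q => q ∣ ((f i).eval (n : ℤ)).toNat ∧ ((f i).eval (n : ℤ)).toNat ≠ 0)) : ℝ) +
        2 * (2 * ((f i).natDegree : ℝ) +
          ((∑ j ∈ range ((f i).natDegree + 1), ((f i).coeff j).natAbs : ℕ) : ℝ)) := by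
      exact_mod_cast h1
    rw [hz]
    linarith
  have hEb0 : 0 ≤ (∑ n ∈ range (x + 1), b n) / ((x : ℝ) + 1) := div_nonneg (sum_nonneg hb0) hY0.le
  have hEbK : (∑ n ∈ range (x + 1), b n) / ((x : ℝ) + 1) ≤ K := by
    rw [div_le_iff₀ hY0]
    calc ∑ n ∈ range (x + 1), b n ≤ ∑ _n ∈ range (x + 1), K := sum_le_sum hbK
      _ = K * ((x : ℝ) + 1) := by rw [sum_const, card_range, nsmul_eq_mul]; push_cast; ring
  have hdefb_le := deficit_le_mean x b
  have hdefb_ge := neg_sq_le_deficit x b K hb0 hbK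
  have hvarb := variance_le_sq x b K hb0 hbK
  /- ### `E a ≤ 2Dk(log log x + 5)` and `Var a ≤ E a + Cge` -/
  have hEa : (∑ n ∈ range (x + 1), a n) / ((x : ℝ) + 1) ≤ 2 * D * k * (Real.log (Real.log x) + 5) := by
    have hsumPz : ∑ q ∈ (Nat.primesLE z ∪ ((Nat.primesLE z).filter (fun p => p ^ 2 ≤ z)).image (fun p => p ^ 2)), (1 : ℝ) / (q : ℝ) ≤
        Real.log (Real.log x) + 5 := by
      refine (sum_PP_le (g := fun q : ℕ => (1 : ℝ) / (q : ℝ)) fun q => by positivity).trans ?_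
      have h1 := Literature.NumberTheory.LFunctions.MertensBound.sum_inv_prime_le z hz2
      have h2 : ∑ p ∈ (Nat.primesLE z).filter (fun p => p ^ 2 ≤ z), (1 : ℝ) / (((p ^ 2 : ℕ) : ℕ) : ℝ) ≤ 1 := by
        refine le_trans (le_of_eq (sum_congr rfl fun p _ => ?_)) (sum_primesLE_sq_inv_le_one z)
        push_cast; ring
      have h1' : ∑ p ∈ Nat.primesLE z, (1 : ℝ) / (p : ℝ) ≤ Real.log (Real.log z) + 4 := h1
      linarith
    calc (∑ n ∈ range (x + 1), a n) / ((x : ℝ) + 1)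
        = ∑ t ∈ (univ : Finset (Fin k)) ×ˢ (Nat.primesLE z ∪ ((Nat.primesLE z).filter (fun p => p ^ 2 ≤ z)).image (fun p => p ^ 2)),
            (∑ n ∈ range (x + 1), Zf t n) / ((x : ℝ) + 1) := by
          simp_rw [← haf]; rw [sum_comm, sum_div]
      _ ≤ ∑ t ∈ (univ : Finset (Fin k)) ×ˢ (Nat.primesLE z ∪ ((Nat.primesLE z).filter (fun p => p ^ 2 ≤ z)).image (fun p => p ^ 2)), 2 * D / (t.2 : ℝ) :=
          sum_le_sum fun t ht => he t (PP_mono hzx (mem_product.1 ht).2)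
      _ = (k : ℝ) * ∑ q ∈ (Nat.primesLE z ∪ ((Nat.primesLE z).filter (fun p => p ^ 2 ≤ z)).image (fun p => p ^ 2)), 2 * D / (q : ℝ) := by
          rw [sum_product]
          simp only [sum_const, card_univ, Fintype.card_fin, nsmul_eq_mul]
      _ = (k : ℝ) * (2 * D * ∑ q ∈ (Nat.primesLE z ∪ ((Nat.primesLE z).filter (fun p => p ^ 2 ≤ z)).image (fun p => p ^ 2)), (1 : ℝ) / (q : ℝ)) := by
          rw [mul_sum _ _ (2 * D)]
          refine congrArg _ (sum_congr rfl fun q _ => ?_)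
          ring
      _ ≤ (k : ℝ) * (2 * D * (Real.log (Real.log x) + 5)) := by gcongr
      _ = 2 * D * k * (Real.log (Real.log x) + 5) := by ring
  have hvara : (∑ n ∈ range (x + 1), a n ^ 2) / ((x : ℝ) + 1) - ((∑ n ∈ range (x + 1), a n) / ((x : ℝ) + 1)) ^ 2 ≤
      2 * D * k * Real.log (Real.log x) + β := by
    rw [hβ]
    linarith
  /- ### Cauchy–Schwarz -/
  have hCS := abs_cov_le_sqrt_mul_sqrt x a b
  have hsqb : Real.sqrt ((∑ n ∈ range (x + 1), b n ^ 2) / ((x : ℝ) + 1) - ((∑ n ∈ range (x + 1), b n) / ((x : ℝ) + 1)) ^ 2) ≤ K := by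
    rw [Real.sqrt_le_left hK0]
    exact hvarb
  have hsqa : Real.sqrt ((∑ n ∈ range (x + 1), a n ^ 2) / ((x : ℝ) + 1) - ((∑ n ∈ range (x + 1), a n) / ((x : ℝ) + 1)) ^ 2) ≤
      Real.sqrt (2 * D * k) * Real.sqrt (Real.log (Real.log x)) + Real.sqrt β := by
    refine (Real.sqrt_le_sqrt hvara).trans ?_
    rw [Real.sqrt_le_left (by positivity), ← Real.sqrt_mul (by positivity), add_sq]
    have h1 := Real.sq_sqrt (show 0 ≤ 2 * D * k * Real.log (Real.log x) by positivity)
    have h2 := Real.sq_sqrt hβ0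
    have h3 := mul_nonneg (Real.sqrt_nonneg (2 * D * k * Real.log (Real.log x))) (Real.sqrt_nonneg β)
    linarith
  have hcov_abs : |(∑ n ∈ range (x + 1), a n * b n) / ((x : ℝ) + 1) -
      (∑ n ∈ range (x + 1), a n) / ((x : ℝ) + 1) * ((∑ n ∈ range (x + 1), b n) / ((x : ℝ) + 1))| ≤
      K * (Real.sqrt (2 * D * k) + Real.sqrt β) * (1 + Real.sqrt (Real.log (Real.log x))) := by
    have hsb0 := Real.sqrt_nonneg ((∑ n ∈ range (x + 1), b n ^ 2) / ((x : ℝ) + 1) - ((∑ n ∈ range (x + 1), b n) / ((x : ℝ) + 1)) ^ 2)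
    have hL0 := Real.sqrt_nonneg (Real.log (Real.log x))
    have h2Dk := Real.sqrt_nonneg (2 * D * k)
    have hβs := Real.sqrt_nonneg β
    have hexp : K * (Real.sqrt (2 * D * k) + Real.sqrt β) * (1 + Real.sqrt (Real.log (Real.log x))) =
        (Real.sqrt (2 * D * k) * Real.sqrt (Real.log (Real.log x)) + Real.sqrt β) * K +
          (K * Real.sqrt (2 * D * k) + K * (Real.sqrt β * Real.sqrt (Real.log (Real.log x)))) := by
      ring
    have h0 : 0 ≤ K * Real.sqrt (2 * D * k) + K * (Real.sqrt β * Real.sqrt (Real.log (Real.log x))) :=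
      add_nonneg (mul_nonneg hK0 h2Dk) (mul_nonneg hK0 (mul_nonneg hβs hL0))
    calc _ ≤ _ := hCS
      _ ≤ (Real.sqrt (2 * D * k) * Real.sqrt (Real.log (Real.log x)) + Real.sqrt β) * K :=
          mul_le_mul hsqa hsqb hsb0 (by positivity)
      _ ≤ K * (Real.sqrt (2 * D * k) + Real.sqrt β) * (1 + Real.sqrt (Real.log (Real.log x))) := by
          rw [hexp]
          linarith
  /- ### the deficit of `s` in terms of `a` and `b` -/
  have hc1 : ((∑ n ∈ Finset.range (x + 1), ∑ i, (((f i).eval (n : ℤ)).toNat.factorization.sum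
      fun _ v => min v 2) : ℕ) : ℝ) = ∑ n ∈ range (x + 1), sN n := by
    rw [Nat.cast_sum, hsN]
  have hc2 : (((∑ n ∈ Finset.range (x + 1), (∑ i, (((f i).eval (n : ℤ)).toNat.factorization.sum
      fun _ v => min v 2)) ^ 2 : ℕ) : ℝ)) = ∑ n ∈ range (x + 1), sN n ^ 2 := by
    rw [Nat.cast_sum, hsN]
    simp only [Nat.cast_pow]
  have hdef := deficit_add_eq x ((x : ℝ) + 1) a b
  simp only [hab] at hdef
  -- the covariance of the statement is `Cov(a, b)`
  have hz' : Nat.sqrt x = z := rfl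
  have hcov1 : (∑ n ∈ Finset.range (x + 1),
      ((∑ i, #((Nat.primesLE (Nat.sqrt x) ∪ ((Nat.primesLE (Nat.sqrt x)).filter (fun p => p ^ 2 ≤ Nat.sqrt x)).image (fun p => p ^ 2)).filter (fun q => q ∣ ((f i).eval (n : ℤ)).toNat ∧ ((f i).eval (n : ℤ)).toNat ≠ 0)) : ℕ) : ℝ) *
        (((∑ i, (((f i).eval (n : ℤ)).toNat.factorization.sum fun _ v => min v 2) : ℕ) : ℝ) -
          ((∑ i, #((Nat.primesLE (Nat.sqrt x) ∪ ((Nat.primesLE (Nat.sqrt x)).filter (fun p => p ^ 2 ≤ Nat.sqrt x)).image (fun p => p ^ 2)).filter (fun q => q ∣ ((f i).eval (n : ℤ)).toNat ∧ ((f i).eval (n : ℤ)).toNat ≠ 0)) : ℕ) : ℝ))) =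
      ∑ n ∈ range (x + 1), a n * b n := by
    refine sum_congr rfl fun n _ => ?_
    rw [hz', hA_eq n, hb, hsN]
  have hcov2 : (∑ n ∈ Finset.range (x + 1),
      ((∑ i, #((Nat.primesLE (Nat.sqrt x) ∪ ((Nat.primesLE (Nat.sqrt x)).filter (fun p => p ^ 2 ≤ Nat.sqrt x)).image (fun p => p ^ 2)).filter (fun q => q ∣ ((f i).eval (n : ℤ)).toNat ∧ ((f i).eval (n : ℤ)).toNat ≠ 0)) : ℕ) : ℝ)) =
      ∑ n ∈ range (x + 1), a n := by
    refine sum_congr rfl fun n _ => ?_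
    rw [hz', hA_eq n]
  have hcov3 : (∑ n ∈ Finset.range (x + 1),
      (((∑ i, (((f i).eval (n : ℤ)).toNat.factorization.sum fun _ v => min v 2) : ℕ) : ℝ) -
        ((∑ i, #((Nat.primesLE (Nat.sqrt x) ∪ ((Nat.primesLE (Nat.sqrt x)).filter (fun p => p ^ 2 ≤ Nat.sqrt x)).image (fun p => p ^ 2)).filter (fun q => q ∣ ((f i).eval (n : ℤ)).toNat ∧ ((f i).eval (n : ℤ)).toNat ≠ 0)) : ℕ) : ℝ))) =
      ∑ n ∈ range (x + 1), b n := by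
    refine sum_congr rfl fun n _ => ?_
    rw [hz', hA_eq n, hb, hsN]
  rw [hc1, hc2, hcov1, hcov2, hcov3]
  refine ⟨?_, hcov_abs⟩
  have hgoal : (∑ n ∈ range (x + 1), sN n) / ((x : ℝ) + 1) -
      ((∑ n ∈ range (x + 1), sN n ^ 2) / ((x : ℝ) + 1) -
        ((∑ n ∈ range (x + 1), sN n) / ((x : ℝ) + 1)) ^ 2) =
      (∑ n ∈ range (x + 1), sN n) / ((x : ℝ) + 1) -
        (∑ n ∈ range (x + 1), sN n ^ 2) / ((x : ℝ) + 1) +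
        ((∑ n ∈ range (x + 1), sN n) / ((x : ℝ) + 1)) ^ 2 := by ring
  rw [hgoal, hdef, abs_le]
  have hK2 := sq_nonneg K
  constructor
  · linarith
  · linarith

end Summit.Parity.BatemanHorn.Cruxes.SystemMomentDeficit.Localisation
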